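import Summits.BirchSwinnertonDyer.BirchSwinnertonDyer.Theorems.ResidualThetaTransportAtTwoThetaLayerLambdaCongruenceAtTwoSocleCosocleModTwo
import Literature.NumberTheory.EllipticCurves.ModularJacobianMultiplicityOneCosocleProofs
import HarnessLib

/-!
# Crux `ThetaLayerLambdaCongruenceAtTwo` (stmt-BirchSwinnertonDyer-20688) — CERTIFICATE for the Buzzard-typing ruling (width seat bsd-wall-rtt-p3-w3 g10):
# the proposed REPLACEMENT text of `buzzard2000_multiplicityOne_gamma0` (Picard reading) is CONSERVATIVE in both directions, kernel-checked

`PicardReading` below is, VERBATIM, the statement proposed in p648238 (bounced on policy «one fact per printed result — propose a REPLACEMENT»):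
the hypothesis list of `buzzard2000_multiplicityOne_gamma0` unchanged, conclusion `finrank (𝕋/𝔪) (periodHomologyHecke N ⧸ 𝔪 • ⊤) = 2`
(Buzzard's `J(Γ)[𝔪]` on the Picard carrier `Hom(Λ, ℤ/2)`). This workfile (not a Theorems file; nothing is asserted) proves:
* `picardReading_of_albanese_of_pairing : buzzard2000_multiplicityOne_gamma0 → periodHomology_exists_heckeSelfAdjoint_perfectPairing → PicardReading`
  (today's typing + IP ⟹ proposed typing; = `finrank_periodHomology_quotient_eq_two_of_buzzard`, the reviewer's `picard_of_tree`);
* `albanese_of_picardReading_of_sd : PicardReading → heckeSelfDual_torsionBy_J0 → buzzard2000_multiplicityOne_gamma0`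
  (proposed typing + SD ⟹ today's typing, pointwise at every `N, 𝔪`; by `finrank_torsionBySet_eq_two_of_sd_cosocle`, p651713).
So a same-name replacement loses NOTHING for any consumer holding SD (all six callers of the four socle apply-sites do), and gains the SD-free
road for Kan⁺ / K1 (`thetaLayerLambdaCongruenceAtTwo_of_cosocleFact`, `mazurTateCongruenceAtTwoTop_of_cosocleFact_periodTwo`). For the GO
executor (lead rtt-p3 g12, memo Lines/birth-buzzard-typing-execution.md): the def text to paste is `PicardReading`'s body; the docstring of p648238
(reading + locators: Buzzard p.100/104, Lange–Birkenhake 4.1.1/4.6.3/5.2.3/5.2.6, DDT §1.3/Thm 1.15, ARS §3) is in Lines/birth-pub1-picard.md §0.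
BSD is not proved by any of this.
-/

set_option autoImplicit false
-- justification: the `Summit.BirchSwinnertonDyer.BirchSwinnertonDyer.…` path repeats a component (route-file convention)
set_option linter.dupNamespace false

noncomputable section

open scoped MatrixGroups ModularForm NumberField
open CongruenceSubgroup Polynomial IsDedekindDomain Rat.HeightOneSpectrum
  Literature.NumberTheory.GaloisRepresentations Literature.NumberTheory.EllipticCurves.ModularForms
  Summit.BirchSwinnertonDyer.BirchSwinnertonDyer.Theorems.ThetaLayerLambdaCongruenceAtTwo

namespace Summit.BirchSwinnertonDyer.BirchSwinnertonDyer.Cruxes.ThetaLayerLambdaCongruenceAtTwo.BuzzardTyping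

/-- The proposed replacement text of `buzzard2000_multiplicityOne_gamma0` (Buzzard 2000 Prop. 2.4 read on the Picard carrier `J[2] = Hom(Λ, ℤ/2)`):
hypotheses VERBATIM, conclusion `dim_{𝕋/𝔪} Λ/𝔪Λ = 2`. A workfile abbreviation for the certificate below — NOT a named fact.
[cite: Buzzard2000LevelLoweringModTwo, Prop. 2.4 and Def. 2.1–2.2 (p. 100–101)] -/
def PicardReading : Prop :=
  ∀ (N : ℕ) [NeZero N], Odd N →
  ∀ (𝔪 : Ideal (HeckeRing0 N 2)), 𝔪.IsMaximal → (2 : HeckeRing0 N 2) ∈ 𝔪 →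
  ∀ (k : Type) [Field k] [IsAlgClosed k] [TopologicalSpace k] [DiscreteTopology k]
    (ι : HeckeRing0 N 2 ⧸ 𝔪 →+* k) (ρ : ModPGaloisRep ℚ k 2),
    (∀ v : HeightOneSpectrum (𝓞 ℚ), ¬ ((primesEquiv v : Nat.Primes) : ℕ) ∣ 2 * N →
      ρ.IsUnramifiedAt v ∧
        ρ.HasFrobCharpolyAt v
          (X ^ 2
            - C (ι (Ideal.Quotient.mk 𝔪 (HeckeRing0.T N 2
                ((primesEquiv v : Nat.Primes) : ℕ) (primesEquiv v : Nat.Primes).2))) * X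
            + C (((primesEquiv v : Nat.Primes) : ℕ) : k))) →
    FramedRep.IsIrreducible ρ →
    (∀ v : HeightOneSpectrum (𝓞 ℚ), ((primesEquiv v : Nat.Primes) : ℕ) = 2 →
      ∀ 𝔓 ∈ v.primesAbove, ∃ σ ∈ 𝔓.decompositionSubgroup (Field.absoluteGaloisGroup ℚ),
        ∀ c : k, ((ρ σ : GL (Fin 2) k) : Matrix (Fin 2) (Fin 2) k) ≠ Matrix.scalar (Fin 2) c) →
    Module.finrank (HeckeRing0 N 2 ⧸ 𝔪)
      (periodHomologyHecke N ⧸ (𝔪 • ⊤ : Submodule (HeckeRing0 N 2) (periodHomologyHecke N))) = 2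

/-- TODAY'S typing + the intersection pairing ⟹ the Picard reading (= `finrank_periodHomology_quotient_eq_two_of_buzzard`).
[cite: DarmonDiamondTaylor1995, §4.5 Thm. 4.26 (pp. 133–134)] -/
theorem picardReading_of_albanese_of_pairing (hBz : buzzard2000_multiplicityOne_gamma0)
    (hIP : periodHomology_exists_heckeSelfAdjoint_perfectPairing) : PicardReading := by
  intro N _ hN 𝔪 h𝔪 h2 k _ _ _ _ ι ρ hU hI hS
  haveI := h𝔪
  exact finrank_periodHomology_quotient_eq_two_of_buzzard hBz hIP N hN 𝔪 h2 k ι ρ hU hI hS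

/-- The Picard reading + SD (the mod-`2` self-duality pairing, item 27800) ⟹ TODAY'S typing, pointwise — so a same-name replacement is conservative for
every consumer that holds SD. [cite: DarmonDiamondTaylor1995, §1.6 Lemma 1.38 and §4.5 (p. 134)] -/
theorem albanese_of_picardReading_of_sd (hPic : PicardReading) (hSD : heckeSelfDual_torsionBy_J0) :
    buzzard2000_multiplicityOne_gamma0 := by
  intro N _ hN 𝔪 h𝔪 h2 k _ _ _ _ ι ρ hU hI hS
  haveI := h𝔪
  exact finrank_torsionBySet_eq_two_of_sd_cosocle hSD 𝔪 h2 (hPic N hN 𝔪 h𝔪 h2 k ι ρ hU hI hS)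

/-- Kan⁺ BY NAME from the Picard reading alone (= `thetaLayerLambdaCongruenceAtTwo_of_cosocleFact`, by unfolding). [cite: Pollack2003, Prop. 6.18] -/
theorem kanPlus_of_picardReading (hPic : PicardReading) :
    Summit.BirchSwinnertonDyer.BirchSwinnertonDyer.Theses.ResidualThetaTransportAtTwo.ThetaLayerLambdaCongruenceAtTwo :=
  thetaLayerLambdaCongruenceAtTwo_of_cosocleFact hPic

end Summit.BirchSwinnertonDyer.BirchSwinnertonDyer.Cruxes.ThetaLayerLambdaCongruenceAtTwo.BuzzardTyping

end
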